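import Summits.Ventures.PackingBounds.Energy.FivePointRieszSixCongrFacts1
import Summits.Ventures.PackingBounds.Energy.FivePointRieszSixCongrFacts1x1
import Summits.Ventures.PackingBounds.Energy.FivePointRieszSixCongrFacts1x2
import Summits.Ventures.PackingBounds.Energy.FivePointRieszSixCongrFacts1x3
import Summits.Ventures.PackingBounds.Energy.FivePointRieszSixCongrFacts1x4
import Summits.Ventures.PackingBounds.Energy.FivePointRieszSixCongrFacts1x5
import Summits.Ventures.PackingBounds.Energy.FivePointRieszSixCongrFacts1x6
import Summits.Ventures.PackingBounds.Energy.FivePointRieszSixCongrFacts1x7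
import Summits.Ventures.PackingBounds.Energy.FivePointRieszSixCongrFacts2
import Summits.Ventures.PackingBounds.Energy.FivePointRieszSixCongrFacts3
import Summits.Ventures.PackingBounds.Energy.FivePointRieszSixCongrFacts4
import Summits.Ventures.PackingBounds.Energy.FivePointRieszSixCongrFacts5
import HarnessLib

/-!
# The congruence `X = P (S·Y) Pᵀ` of `e3pt-sharp-n3N5s6d8-none.json` holds (collected chunks)

Framing: lottery ticket; floor = certified bounds/negative ranges. Venture `PackingBounds`, cell
`pub-packcert`, energy family E3PT (pub-packcert-energy gen 15; n = 3, d = 8 kernel route = KERNEL-D6 double data route, size-split).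

`congrR6_all` collects the chunk theorems of `FivePointRieszSixCongrFacts*` for `GramData.listQuad_nonneg_of_congr` (used in `FivePointRieszSixSOS`).
-/

namespace Summit.Ventures.PackingBounds.Energy.RieszSixD8

open Summit.Ventures.PackingBounds.Energy.GramData

/-- All entries: `X_ab = Σ_i Σ_j P_ai (S·Y)_ij P_bj` for `a, b < 165` (in the checker's recursive form). -/
theorem congrR6_all : ∀ a b, a < 165 → b < 165 →
    ent xR6 a b = cgOuter yR6 (bR6.getD b []) (bR6.getD a []) 0 := by
  intro a b ha hb
  by_cases h0 : a < 9
  · exact of_checkCongr congrR6_0_9 a b (Nat.zero_le _) h0 hb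
  by_cases h1 : a < 10
  · exact of_checkCongr congrR6_9_10 a b (by omega) h1 hb
  by_cases h2 : a < 11
  · have hae : a = 10 := by omega
    subst hae
    by_cases g0 : b < 10
    · exact of_checkCongrCols congrR6_10c_0_10 b (Nat.zero_le _) g0
    by_cases g1 : b < 14
    · exact of_checkCongrCols congrR6_10c_10_14 b (by omega) g1
    by_cases g2 : b < 82
    · exact of_checkCongrCols congrR6_10c_14_82 b (by omega) g2
    by_cases g3 : b < 159
    · exact of_checkCongrCols congrR6_10c_82_159 b (by omega) g3
    · exact of_checkCongrCols congrR6_10c_159_165 b (by omega) hb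
  by_cases h3 : a < 33
  · exact of_checkCongr congrR6_11_33 a b (by omega) h3 hb
  by_cases h4 : a < 44
  · exact of_checkCongr congrR6_33_44 a b (by omega) h4 hb
  by_cases h5 : a < 55
  · exact of_checkCongr congrR6_44_55 a b (by omega) h5 hb
  by_cases h6 : a < 66
  · exact of_checkCongr congrR6_55_66 a b (by omega) h6 hb
  by_cases h7 : a < 77
  · exact of_checkCongr congrR6_66_77 a b (by omega) h7 hb
  by_cases h8 : a < 88
  · exact of_checkCongr congrR6_77_88 a b (by omega) h8 hb
  by_cases h9 : a < 99
  · exact of_checkCongr congrR6_88_99 a b (by omega) h9 hb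
  by_cases h10 : a < 110
  · exact of_checkCongr congrR6_99_110 a b (by omega) h10 hb
  by_cases h11 : a < 121
  · exact of_checkCongr congrR6_110_121 a b (by omega) h11 hb
  by_cases h12 : a < 132
  · exact of_checkCongr congrR6_121_132 a b (by omega) h12 hb
  by_cases h13 : a < 143
  · exact of_checkCongr congrR6_132_143 a b (by omega) h13 hb
  by_cases h14 : a < 154
  · exact of_checkCongr congrR6_143_154 a b (by omega) h14 hb
  · exact of_checkCongr congrR6_154_165 a b (by omega) ha hb

end Summit.Ventures.PackingBounds.Energy.RieszSixD8
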